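import Summits.BirchSwinnertonDyer.Rank1Residual.Additive.LocalTowerKernelAtPTwistedOrdinary
import Summits.BirchSwinnertonDyer.Rank1Residual.Additive.AdditiveFixedPointsTorsion
import Literature.NumberTheory.EllipticCurves.DivisionPolynomialTorsion
import HarnessLib

/-!
# The `v = p` local tower kernel at level `0` VANISHES along ANY `Γ_{ℚ_v}`-stable `p`-divisible
# subgroup `A₁ ≤ E(K̄_v)` with torsion quotient, a cyclic `A₁[p]` and a moving element of `(ker κ)_v`
# — `W.localTowerKerPrimary κ ℚ_v 0 = ⊥` (team n1011, row T-T3M, seat p12 GEN 9; file F2-M: the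
# model-free form of row T-T3B's F5 END, with the F4 inputs `hTfin`/`hu` DERIVED from p07's engine)

HONEST FRAMING (cell `b2b-bsdres`, run/shared/lean/b2b/bsd-rank1-residual/, verbatim in every
file): the goal of the cell is to DELETE the COMBINATION-SHAPED residual classes of the
Birch–Swinnerton-Dyer formula for ALL analytic-rank `≤ 1` elliptic curves over `ℚ` — "full BSD
formula for every rank `≤ 1` curve in class `C`" assembled STRICTLY from published theorems — so
that the rank-`≤ 1` remainder becomes exactly the CONSTRUCTION-SHAPED classes, which are TYPED
(missing-input `Prop`s), NOT attempted. This is not "finishing BSD". Team n1011 (N10/N11; row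
T-T3M = the (M) sibling of T-T3B, skeleton `cells/n1011/skel/T-T3M.md`): research routes on
CONSTRUCTION-SHAPED classes (ROUTE 2 / Route G partners); prove what is provable now; no claim
beyond stated classes; census output = EVIDENCE, never a Literature fact; RESIDUAL-MAP marks
UNCHANGED; nothing is booked by this file. TOOL THEOREMS ONLY: no definition, no named fact, nothing
cited enters as a hypothesis. It closes no class by itself.

## What

Row T-T3B's END (`GoodModelLine.localTowerKerPrimary_zero_eq_bot_of_goodModel`, file
`Additive/LocalTowerKernelAtPTwistedOrdinary`) ran Greenberg's Lemma 3.4 dévissage through the kernel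
of reduction `A₁ = ker red` of a GOOD MODEL. Its proof used the model only through: `A₁` is
`Γ_{ℚ_v}`-stable, `p`-divisible, with torsion quotient, `A₁[p]` cyclic of order `p`, and the four
F4 inputs `hdiv₁ htor hTfin hu`. THIS FILE states the END for an ARBITRARY such subgroup
`A₁ ≤ E(K̄_v)` at an ADDITIVE `v ∋ p`, and DERIVES `hTfin` / `hu` inside from p07's model-free
FixedLevel engine (`Additive/AdditiveFixedPointsTorsion`: one `N > 0` kills every `Γ_{ℚ_v}`-fixed
torsion point; a fixed point `pⁿ`-divisible modulo fixed torsion for every `n` is torsion; a fixed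
point of infinite order exists) together with `htor` — verbatim the arguments of p07's
`GoodModelLine.finite_fixed_primary_red_ker` / `exists_fixed_red_ker_not_pdivisible` with
"`red P = Õ`" replaced by "`P ∈ A₁`":

  `StableSubgroupLine.localTowerKerPrimary_zero_eq_bot_of_stableSubgroup
     (hpv) (hadd) (κ) (A₁) (hA₁) (hdiv₁) (htor) (hP₁) (hP₁ord) (hK) (hmove) :
     W.localTowerKerPrimary κ (v.adicCompletion ℚ) 0 = ⊥`,

and, with the two fixed-point facts DISPLAYED instead of derived (no reduction type on `v`, so that
good or multiplicative engines can plug in), the core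
`StableSubgroupLine.localTowerKerPrimary_zero_eq_bot_of_stableSubgroup_of_facts (hpv) (κ) (A₁)
(hTfin) (hu₁) (huG) (hu) (hA₁) (hdiv₁) (htor) (hP₁) (hP₁ord) (hK) (hmove)`. (A₁ = ker red of a
good model is row T-T3B's F5, p304138, NOT re-landed; only A40/A41 are ever named facts downstream.)

The row's END (file F4-M, `AdditivePotMult/LocalTowerKernelAtPPotMult`) instantiates
`A₁ := Ψ(𝒪̄ˣ)`, the image of the UNITS of `K̄_v` under the twisted Tate parametrisation
`Ψ : K̄_vˣ → E(K̄_v)` of an additive potentially multiplicative `E` (A41 on the `p*`-twist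
model, transported): the statement in print is Delbourgo, Compositio 113 (1998) §2.2 Lemma (ii)
(p. 139), proved there by universal norms; here by Greenberg's count. Mechanism recalled: (S2) a
`p`-torsion class of `H¹(Γ_{ℚ_v}, A/A₁)` dying on `N = (ker κ)_v` vanishes because `(A/A₁)[p]^N = 0`
(`hmove`: `PrimeTorsionLine.mem_of_sub_mem_of_moves`); (S3) so the class is `A₁ ∩ A[p^m]`-valued
(F1 `ResKernelPrimary.exists_kerValued_cocycle_of_pow_smul_eq_zero`); (S4) the Kummer count
`#H¹(ℚ_v, A₁[p]) ≤ p · #A₁[p]^Γ ≤ #(A₁^Γ/p)` (F3 `PrimeOrderLine.exists_finset_cocycle_reps` —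
Tate EPC + local duality (2,0) + "the character of `A₁[p]` is not `ω`" from F5a
`exists_lineScalar_quotScalar` and the Weil scalar lemma — fed to F2
`KummerCount.oneCocycleClass_eq_zero_of_kerValued`); (S5) F5b.

References: [GreenbergLNM1716] R. Greenberg, LNM 1716 (1999), §3 Lemma 3.4 (p. 89), Prop. 3.8;
[Delbourgo1998] D. Delbourgo, Compositio Math. 113 (1998) 123–153, §2.2 Lemma (p. 139);
[MilneADT2006] I Thm. 2.8, Cor. 2.3; [SilvermanAEC2009] III.6.4, III.8.1, VII.2.2, VII.6.1, VII.6.3;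
cells/n1011/skel/T-T3M.md; row T-T3B files F1 F2 F3 F5a F5b F5 (p12 GEN 8), F4 (p07 GEN 9).
-/

noncomputable section

open scoped Classical NNReal

open WeierstrassCurve

universe u

namespace Summit.BirchSwinnertonDyer.Rank1Residual.Additive.StableSubgroupLine

open NumberField IsDedekindDomain Field IsDedekindDomain.HeightOneSpectrum
  Literature.NumberTheory.GaloisRepresentations
  Literature.NumberTheory.EllipticCurves
  Literature.NumberTheory.EllipticCurves.ResKernel
  Literature.NumberTheory.EllipticCurves.GreenbergSelmer
  Summit.BirchSwinnertonDyer.Rank1Residual.Iwasawa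
  Summit.BirchSwinnertonDyer.Rank1Residual.Additive

variable (W : WeierstrassCurve ℚ) [W.IsElliptic] (p : ℕ) [hp : Fact p.Prime]
  {v : HeightOneSpectrum (𝓞 ℚ)}

/-! ## §1 The two F4 inputs for ANY stable subgroup with torsion quotient -/

/-- **`hTfin` for any subgroup, from ONE killing exponent**: if some `N > 0` kills every
`Γ_{ℚ_v}`-fixed torsion point of `E(K̄_v)` (`hkill`; at an additive `v ∋ p` this is p07's
`FixedLevel.exists_nsmul_eq_zero_of_fixed_of_isOfFinAddOrder`), the fixed `p`-power torsion points
lying in `A₁` form a FINITE set (`E(K̄_v)[N]` is finite, `finite_torsionBy_of_isAlgClosed`);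
membership in `A₁` is not used. Verbatim p07's `GoodModelLine.finite_fixed_primary_red_ker` with
`ker red ↦ A₁`. [cite: SilvermanAEC2009, Thm. VII.6.1, Prop. VII.2.2, VII.3.1 and Cor. III.6.4] -/
theorem finite_fixed_primary_mem_of_kill
    (hkill : ∃ N : ℕ, 0 < N ∧ ∀ R : localPoints W (v.adicCompletion ℚ),
      (∀ σ : absoluteGaloisGroup (v.adicCompletion ℚ), σ • R = R) → IsOfFinAddOrder R → N • R = 0)
    (A₁ : AddSubgroup (localPoints W (v.adicCompletion ℚ))) :
    Set.Finite {P : localPoints W (v.adicCompletion ℚ) | P ∈ A₁ ∧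
      (∀ σ : absoluteGaloisGroup (v.adicCompletion ℚ), σ • P = P) ∧ ∃ k : ℕ, p ^ k • P = 0} := by
  obtain ⟨N, hN, hkill⟩ := hkill
  have hN0 : (N : ℤ) ≠ 0 := by exact_mod_cast hN.ne'
  haveI : Finite (AddSubgroup.torsionBy (localPoints W (v.adicCompletion ℚ)) (N : ℤ)) :=
    finite_torsionBy_of_isAlgClosed (V := W.baseChange (AlgebraicClosure (v.adicCompletion ℚ))) hN0
  refine Set.Finite.subset ((AddSubgroup.torsionBy (localPoints W (v.adicCompletion ℚ)) (N : ℤ) :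
      Set (localPoints W (v.adicCompletion ℚ))).toFinite) (fun P hP ↦ ?_)
  obtain ⟨-, hfix, k, hk⟩ := hP
  have htor : IsOfFinAddOrder P :=
    isOfFinAddOrder_iff_nsmul_eq_zero.mpr ⟨p ^ k, pow_pos hp.out.pos k, hk⟩
  change P ∈ AddSubgroup.torsionBy (localPoints W (v.adicCompletion ℚ)) (N : ℤ)
  rw [mem_torsionBy_iff, natCast_zsmul]
  exact hkill P hfix htor

/-- **`hTfin` for any subgroup at an ADDITIVE `v ∋ p`** (p07's engine supplies the killing exponent).
[cite: SilvermanAEC2009, Thm. VII.6.1, Prop. VII.2.2, VII.3.1 and Cor. III.6.4] -/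
theorem finite_fixed_primary_mem (hpv : ((p : ℕ) : 𝓞 ℚ) ∈ v.asIdeal)
    (hadd : W.HasAdditiveReductionAt v) (A₁ : AddSubgroup (localPoints W (v.adicCompletion ℚ))) :
    Set.Finite {P : localPoints W (v.adicCompletion ℚ) | P ∈ A₁ ∧
      (∀ σ : absoluteGaloisGroup (v.adicCompletion ℚ), σ • P = P) ∧ ∃ k : ℕ, p ^ k • P = 0} :=
  finite_fixed_primary_mem_of_kill W p
    (FixedLevel.exists_nsmul_eq_zero_of_fixed_of_isOfFinAddOrder W p hpv hadd) A₁

omit [W.IsElliptic] in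
/-- **`hu` for any subgroup with torsion quotient, from two facts about fixed points**: if a point
that is `pⁿ`-divisible modulo fixed torsion by fixed points for every `n` is torsion (`hdivtor`) and a
fixed point of infinite order exists (`hinf`) — at an additive `v ∋ p` p07's
`FixedLevel.isOfFinAddOrder_of_forall_exists_fixed` / `exists_fixed_not_isOfFinAddOrder` — and every
point has a positive multiple in `A₁` (`htor`), then some fixed `u ∈ A₁` is NOT `p • c + t` with
`c ∈ A₁` fixed and `t ∈ A₁` fixed `p`-power torsion. Verbatim p07's
`GoodModelLine.exists_fixed_red_ker_not_pdivisible` with `ker red ↦ A₁`, (F4.c) `↦ htor`.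
[cite: SilvermanAEC2009, Prop. VII.2.2 and Prop. VII.6.3] [cite: GreenbergLNM1716, §3 Lemma 3.4 (p. 89)] -/
theorem exists_fixed_mem_not_pdivisible_of_facts
    (hdivtor : ∀ R : localPoints W (v.adicCompletion ℚ),
      (∀ n : ℕ, ∃ c t : localPoints W (v.adicCompletion ℚ),
        (∀ σ : absoluteGaloisGroup (v.adicCompletion ℚ), σ • c = c) ∧
        (∀ σ : absoluteGaloisGroup (v.adicCompletion ℚ), σ • t = t) ∧ IsOfFinAddOrder t ∧
        R = p ^ n • c + t) → IsOfFinAddOrder R)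
    (hinf : ∃ u : localPoints W (v.adicCompletion ℚ),
      (∀ σ : absoluteGaloisGroup (v.adicCompletion ℚ), σ • u = u) ∧ ¬ IsOfFinAddOrder u)
    (A₁ : AddSubgroup (localPoints W (v.adicCompletion ℚ)))
    (htor : ∀ a : localPoints W (v.adicCompletion ℚ), ∃ n : ℕ, 0 < n ∧ n • a ∈ A₁) :
    ∃ u : localPoints W (v.adicCompletion ℚ), u ∈ A₁ ∧
      (∀ σ : absoluteGaloisGroup (v.adicCompletion ℚ), σ • u = u) ∧
      ∀ c t : localPoints W (v.adicCompletion ℚ), c ∈ A₁ →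
        (∀ σ : absoluteGaloisGroup (v.adicCompletion ℚ), σ • c = c) → t ∈ A₁ →
        (∀ σ : absoluteGaloisGroup (v.adicCompletion ℚ), σ • t = t) → (∃ k : ℕ, p ^ k • t = 0) →
        u ≠ p • c + t := by
  obtain ⟨u₀, hu₀fix, hu₀tor⟩ := hinf
  obtain ⟨n, hn, hnu⟩ := htor u₀
  have hu₁fix : ∀ σ : absoluteGaloisGroup (v.adicCompletion ℚ), σ • (n • u₀) = n • u₀ :=
    fun σ ↦ by rw [smul_comm, hu₀fix σ]
  by_contra hcon
  push Not at hcon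
  -- every fixed element of `A₁` is `pᵐ`-divisible modulo fixed torsion, for every `m`
  have key : ∀ (m : ℕ) (u : localPoints W (v.adicCompletion ℚ)), u ∈ A₁ →
      (∀ σ : absoluteGaloisGroup (v.adicCompletion ℚ), σ • u = u) →
      ∃ c t : localPoints W (v.adicCompletion ℚ),
        (∀ σ : absoluteGaloisGroup (v.adicCompletion ℚ), σ • c = c) ∧
        (∀ σ : absoluteGaloisGroup (v.adicCompletion ℚ), σ • t = t) ∧ IsOfFinAddOrder t ∧
        u = p ^ m • c + t := by
    intro m
    induction m with
    | zero =>
      intro u _ hfix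
      exact ⟨u, 0, hfix, fun σ ↦ smul_zero σ, IsOfFinAddOrder.zero,
        by rw [pow_zero, one_smul, add_zero]⟩
    | succ m ih =>
      intro u hu hfix
      obtain ⟨c, t, hc, hcfix, ht, htfix, ⟨k, hk⟩, rfl⟩ := hcon u hu hfix
      obtain ⟨c', t', hc'fix, ht'fix, ht'tor, hceq⟩ := ih c hc hcfix
      refine ⟨c', p • t' + t, hc'fix, fun σ ↦ ?_, ?_, ?_⟩
      · rw [smul_add, smul_comm, ht'fix σ, htfix σ]
      · exact (ht'tor.nsmul : IsOfFinAddOrder (p • t')).add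
          (isOfFinAddOrder_iff_nsmul_eq_zero.mpr ⟨p ^ k, pow_pos hp.out.pos k, hk⟩)
      · rw [hceq, smul_add, ← mul_smul, ← pow_succ', add_assoc]
  have htor' : IsOfFinAddOrder (n • u₀) := hdivtor _ fun m ↦ key m (n • u₀) hnu hu₁fix
  obtain ⟨m, hm, hmu⟩ := isOfFinAddOrder_iff_nsmul_eq_zero.mp htor'
  exact hu₀tor (isOfFinAddOrder_iff_nsmul_eq_zero.mpr ⟨m * n, Nat.mul_pos hm hn, by rw [mul_smul, hmu]⟩)

/-- **`hu` for any subgroup with torsion quotient at an ADDITIVE `v ∋ p`** (p07's engine supplies the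
two fixed-point facts). [cite: SilvermanAEC2009, Prop. VII.2.2 and Prop. VII.6.3] [cite: GreenbergLNM1716, §3 Lemma 3.4 (p. 89)] -/
theorem exists_fixed_mem_not_pdivisible (hpv : ((p : ℕ) : 𝓞 ℚ) ∈ v.asIdeal)
    (hadd : W.HasAdditiveReductionAt v) (A₁ : AddSubgroup (localPoints W (v.adicCompletion ℚ)))
    (htor : ∀ a : localPoints W (v.adicCompletion ℚ), ∃ n : ℕ, 0 < n ∧ n • a ∈ A₁) :
    ∃ u : localPoints W (v.adicCompletion ℚ), u ∈ A₁ ∧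
      (∀ σ : absoluteGaloisGroup (v.adicCompletion ℚ), σ • u = u) ∧
      ∀ c t : localPoints W (v.adicCompletion ℚ), c ∈ A₁ →
        (∀ σ : absoluteGaloisGroup (v.adicCompletion ℚ), σ • c = c) → t ∈ A₁ →
        (∀ σ : absoluteGaloisGroup (v.adicCompletion ℚ), σ • t = t) → (∃ k : ℕ, p ^ k • t = 0) →
        u ≠ p • c + t :=
  exists_fixed_mem_not_pdivisible_of_facts W p
    (fun _ h ↦ FixedLevel.isOfFinAddOrder_of_forall_exists_fixed W p hpv hadd h)
    (FixedLevel.exists_fixed_not_isOfFinAddOrder W p hpv hadd) A₁ htor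

/-! ## §2 The model-free END -/

set_option maxHeartbeats 800000 in
/-- **T-T3M F2-M (generic core) — `𝒦_{v,0}[p^∞] = 0` at `v ∋ p` along ANY stable `p`-divisible
subgroup with torsion quotient, cyclic `A₁[p]` and a moving element of `(ker κ)_v`, given the two
fixed-point facts.** Hypotheses: `hpv`; the fixed-point facts `hTfin` (fixed `p`-power torsion in `A₁`
finite) and `hu` (a fixed `u ∈ A₁` off `p A₁^Γ + A₁^Γ[p^∞]`) — at an ADDITIVE place both follow from
p07's engine (§1; corollary below), at other reduction types from their own engines; ANY
`ℤ_p`-extension `κ` of `ℚ`; a subgroup `A₁ ≤ E(K̄_v)` which is `Γ_{ℚ_v}`-stable (`hA₁`), `p`-divisible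
(`hdiv₁`), with every point of `E(K̄_v)` having a positive multiple in it (`htor`), an element
`P₁ ∈ A₁` of order `p` generating `A₁ ∩ E[p]` (`hP₁`, `hP₁ord`, `hK`), and `hmove`: some `σ ∈ (ker κ)_v`
and `P ∈ E[p]` with `σP − P ∉ A₁`. Conclusion: `W.localTowerKerPrimary κ (v.adicCompletion ℚ) 0 = ⊥`.
Proof = row T-T3B's F5 END verbatim with `ker red ↦ A₁` (F5b ∘ F1 ∘ F2 with F3's count, `hχ` from
F5a + the Weil scalar lemma `localPoints_exists_isPrimitiveRoot_smul_eq_pow`, `#(ℤ_v/p) = p`).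
Greenberg, LNM 1716, Lemma 3.4 with both anomalous factors `= 1`.
[cite: GreenbergLNM1716, §3 Lemma 3.4 (p. 89) and Prop. 3.8 (p. 95)]
[cite: MilneADT2006, Ch. I §2, Thm. 2.8 (p. 31) and Cor. 2.3] -/
theorem localTowerKerPrimary_zero_eq_bot_of_stableSubgroup_of_facts
    (hpv : ((p : ℕ) : 𝓞 ℚ) ∈ v.asIdeal) (κ : ZpExtension ℚ p)
    (A₁ : AddSubgroup (localPoints W (v.adicCompletion ℚ)))
    (hTfin : Set.Finite {P : localPoints W (v.adicCompletion ℚ) | P ∈ A₁ ∧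
      (∀ σ : absoluteGaloisGroup (v.adicCompletion ℚ), σ • P = P) ∧ ∃ k : ℕ, p ^ k • P = 0})
    {u : localPoints W (v.adicCompletion ℚ)} (hu₁ : u ∈ A₁)
    (huG : ∀ σ : absoluteGaloisGroup (v.adicCompletion ℚ), σ • u = u)
    (hu : ∀ c t : localPoints W (v.adicCompletion ℚ), c ∈ A₁ →
        (∀ σ : absoluteGaloisGroup (v.adicCompletion ℚ), σ • c = c) → t ∈ A₁ →
        (∀ σ : absoluteGaloisGroup (v.adicCompletion ℚ), σ • t = t) → (∃ k : ℕ, p ^ k • t = 0) →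
        u ≠ p • c + t)
    (hA₁ : ∀ (σ : absoluteGaloisGroup (v.adicCompletion ℚ)) (a : localPoints W (v.adicCompletion ℚ)),
      a ∈ A₁ → σ • a ∈ A₁)
    (hdiv₁ : ∀ a ∈ A₁, ∃ b ∈ A₁, p • b = a)
    (htor : ∀ a : localPoints W (v.adicCompletion ℚ), ∃ n : ℕ, 0 < n ∧ n • a ∈ A₁)
    {P₁ : localPoints W (v.adicCompletion ℚ)} (hP₁ : P₁ ∈ A₁) (hP₁ord : addOrderOf P₁ = p)
    (hK : ∀ P ∈ A₁, p • P = 0 → ∃ c : ℕ, P = c • P₁)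
    (hmove : ∃ σ ∈ localSubgroup κ.kerSubgroup (v.adicCompletion ℚ),
      ∃ P : localPoints W (v.adicCompletion ℚ), p • P = 0 ∧ σ • P - P ∉ A₁) :
    W.localTowerKerPrimary κ (v.adicCompletion ℚ) 0 = ⊥ := by
  have hcont : ∀ a : localPoints W (v.adicCompletion ℚ),
      Continuous fun g : absoluteGaloisGroup (v.adicCompletion ℚ) ↦ g • a :=
    continuous_smul_localPoints W (v.adicCompletion ℚ)
  have hdiv : ∀ a : localPoints W (v.adicCompletion ℚ), ∃ b : localPoints W (v.adicCompletion ℚ),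
      p • b = a := fun a ↦
    nsmul_surjective_of_isAlgClosed (V := W.baseChange (AlgebraicClosure (v.adicCompletion ℚ)))
      hp.out.ne_zero a
  -- a topological generator of `Γ_v / (ker κ)_v`
  obtain ⟨g, -, hgen⟩ := ZpExtension.exists_mem_localSubgroup_generate κ (v.adicCompletion ℚ) 0
  have hmem0 : ∀ σ : absoluteGaloisGroup (v.adicCompletion ℚ),
      σ ∈ localSubgroup (κ.layerSubgroup 0) (v.adicCompletion ℚ) := fun σ ↦ by
    rw [mem_localSubgroup_iff, ZpExtension.layerSubgroup_zero]
    exact Subgroup.mem_top _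
  have hgen' : ∀ U : Subgroup (absoluteGaloisGroup (v.adicCompletion ℚ)),
      IsOpen (U : Set (absoluteGaloisGroup (v.adicCompletion ℚ))) →
        localSubgroup κ.kerSubgroup (v.adicCompletion ℚ) ≤ U → g ∈ U → U = ⊤ :=
    fun U hU hHiU hgU ↦ eq_top_iff.mpr fun σ _ ↦ hgen U hU hHiU hgU (hmem0 σ)
  have hP₁p : p • P₁ = 0 := by rw [← hP₁ord]; exact addOrderOf_nsmul_eq_zero P₁
  -- `#E[p] = p²`
  have hcardA : Nat.card {Q : localPoints W (v.adicCompletion ℚ) // p • Q = 0} = p ^ 2 := by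
    have h : Nat.card (AddSubgroup.torsionBy
        (W.baseChange (AlgebraicClosure (v.adicCompletion ℚ))).toAffine.Point (p : ℤ)) = p ^ 2 := by
      have hn : ((p : ℕ) : AlgebraicClosure (v.adicCompletion ℚ)) ≠ 0 := by
        haveI : CharZero (AlgebraicClosure (v.adicCompletion ℚ)) := charZero_of_injective_algebraMap
          (algebraMap ℚ (AlgebraicClosure (v.adicCompletion ℚ))).injective
        exact_mod_cast hp.out.ne_zero
      exact card_torsionBy_eq_sq (E := W.baseChange (AlgebraicClosure (v.adicCompletion ℚ))) hn
    rw [← h]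
    exact Nat.card_congr
      { toFun := fun x ↦ ⟨(show (W.baseChange (AlgebraicClosure (v.adicCompletion ℚ))).toAffine.Point
            from x.1), (Submodule.mem_torsionBy_iff (R := ℤ) _ _).mpr (by
          rw [natCast_zsmul]; exact x.2)⟩
        invFun := fun x ↦ ⟨(show localPoints W (v.adicCompletion ℚ) from x.1), by
          have hx := (Submodule.mem_torsionBy_iff (R := ℤ) _ _).mp x.2
          rw [natCast_zsmul] at hx
          exact hx⟩
        left_inv := fun _ ↦ rfl
        right_inv := fun _ ↦ rfl }
  -- the moving element, as an endomorphism
  obtain ⟨σ, hσN, Pm, hPm, hσPm⟩ := hmove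
  let σ' : localPoints W (v.adicCompletion ℚ) →+ localPoints W (v.adicCompletion ℚ) :=
    DistribSMul.toAddMonoidHom (localPoints W (v.adicCompletion ℚ)) σ
  have hσ' : ∀ a : localPoints W (v.adicCompletion ℚ), σ' a = σ • a := fun _ ↦ rfl
  have hσ'K : ∀ P ∈ A₁, σ' P ∈ A₁ := fun P hP ↦ hA₁ σ P hP
  have hσ'inj : Function.Injective σ' := fun a b h ↦ MulAction.injective σ (by
    change σ • a = σ • b
    rw [← hσ', ← hσ']; exact h)
  have hmove' : ∃ P : localPoints W (v.adicCompletion ℚ), p • P = 0 ∧ σ' P - P ∉ A₁ :=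
    ⟨Pm, hPm, hσPm⟩
  -- (S2) no `p`-torsion in `(E(K̄_v)/A₁)^{(ker κ)_v}`
  have hnp : ∀ a : localPoints W (v.adicCompletion ℚ),
      (∀ n ∈ localSubgroup κ.kerSubgroup (v.adicCompletion ℚ), n • a - a ∈ A₁) → p • a ∈ A₁ →
        a ∈ A₁ := by
    intro a haN hpa
    obtain ⟨t, hpt, hat⟩ := ResKernelPrimary.exists_psmul_eq_zero_sub_mem p A₁ hdiv₁ hpa
    have hσt : σ' t - t ∈ A₁ := by
      have h1 : σ • a - a ∈ A₁ := haN σ hσN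
      have h2 : σ • (a - t) - (a - t) ∈ A₁ := A₁.sub_mem (hA₁ σ _ hat) hat
      have h3 : σ' t - t = (σ • a - a) - (σ • (a - t) - (a - t)) := by
        rw [hσ', smul_sub]; abel
      rw [h3]; exact A₁.sub_mem h1 h2
    have ht : t ∈ A₁ :=
      PrimeTorsionLine.mem_of_sub_mem_of_moves A₁ hP₁ hP₁ord hcardA σ' hσ'K hmove' hpt hσt
    have : a = (a - t) + t := by abel
    rw [this]; exact A₁.add_mem hat ht
  -- (S4) the count: `A₁[p]` as a subgroup of prime order with a non-cyclotomic character
  let Cp : AddSubgroup (localPoints W (v.adicCompletion ℚ)) :=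
    { carrier := {P | P ∈ A₁ ∧ p • P = 0}
      zero_mem' := ⟨A₁.zero_mem, smul_zero _⟩
      add_mem' := fun {a b} ha hb ↦ ⟨A₁.add_mem ha.1 hb.1, by rw [smul_add, ha.2, hb.2, add_zero]⟩
      neg_mem' := fun {a} ha ↦ ⟨A₁.neg_mem ha.1, by rw [smul_neg, ha.2, neg_zero]⟩ }
  have hCpstab : ∀ (τ : absoluteGaloisGroup (v.adicCompletion ℚ))
      (a : localPoints W (v.adicCompletion ℚ)), a ∈ Cp → τ • a ∈ Cp := fun τ a ha ↦
    ⟨hA₁ τ a ha.1, by rw [smul_comm, ha.2, smul_zero]⟩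
  have hpCp : ∀ a ∈ Cp, p • a = 0 := fun a ha ↦ ha.2
  have hCpeq : Cp = AddSubgroup.zmultiples P₁ := by
    refine le_antisymm (fun Q hQ ↦ ?_) (AddSubgroup.zmultiples_le.mpr ⟨hP₁, hP₁p⟩)
    obtain ⟨c, rfl⟩ := hK Q hQ.1 hQ.2
    exact AddSubgroup.mem_zmultiples_iff.mpr ⟨c, natCast_zsmul P₁ c⟩
  have hcardCp : Nat.card Cp = p := by rw [hCpeq, Nat.card_zmultiples, hP₁ord]
  -- the scalars and the Weil pairing: `σ` acts on `A₁[p]` by `a`, on `μ_p` by `c' a`, `a ≢ c' a`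
  obtain ⟨a, c', hline, hquot, -, -, hac⟩ := PrimeTorsionLine.exists_lineScalar_quotScalar A₁
    hP₁ hP₁ord hK hcardA σ' hσ'inj hσ'K hmove'
  have hP₁ord1 : addOrderOf P₁ = p ^ 1 := by rw [pow_one]; exact hP₁ord
  obtain ⟨ζ, hζ, hσζ⟩ := @WeierstrassCurve.localPoints_exists_isPrimitiveRoot_smul_eq_pow ℚ _ W _
    (v.adicCompletion ℚ) _ _
    (charZero_of_injective_algebraMap (algebraMap ℚ (v.adicCompletion ℚ)).injective) p _ 1 P₁
    hP₁ord1 ({σ} : Set (absoluteGaloisGroup (v.adicCompletion ℚ))) (fun _ ↦ a) (fun _ ↦ c')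
    (fun τ hτ ↦ by
      rw [Set.mem_singleton_iff.mp hτ, ← hσ']
      exact hline P₁ hP₁ hP₁p)
    (fun τ hτ Q hQ ↦ by
      rw [Set.mem_singleton_iff.mp hτ, ← hσ']
      exact hquot Q (by rwa [natCast_zsmul, pow_one] at hQ))
  have hσζ' : σ • ζ = ζ ^ (c' * a) := hσζ σ (Set.mem_singleton σ)
  rw [pow_one] at hζ
  have hσμ : ∀ ξ : AlgebraicClosure (v.adicCompletion ℚ), ξ ^ p = 1 → σ • ξ = ξ ^ (c' * a) := by
    intro ξ hξ
    obtain ⟨i, -, rfl⟩ := hζ.eq_pow_of_pow_eq_one hξ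
    rw [smul_pow', hσζ', ← pow_mul, ← pow_mul, Nat.mul_comm]
  have hχ : ∃ (τ : absoluteGaloisGroup (v.adicCompletion ℚ)) (a₀ b₀ : ℕ), (∀ c ∈ Cp, τ • c = a₀ • c) ∧
      (∀ ξ : AlgebraicClosure (v.adicCompletion ℚ), ξ ^ p = 1 → τ • ξ = ξ ^ b₀) ∧
      ¬ a₀ ≡ b₀ [MOD p] :=
    ⟨σ, a, c' * a, fun c hc ↦ by rw [← hσ']; exact hline c hc.1 hc.2, hσμ, hac⟩
  obtain ⟨S, hS, hrep⟩ := PrimeOrderLine.exists_finset_cocycle_reps ℚ v hcont p Cp hCpstab hpCp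
    hcardCp hχ
  have hS' : S.card ≤ p * Nat.card {x : localPoints W (v.adicCompletion ℚ) // x ∈ A₁ ∧
      (∀ τ : absoluteGaloisGroup (v.adicCompletion ℚ), τ • x = x) ∧ p • x = 0} := by
    rw [GoodModelLine.natCard_adicCompletionIntegers_quot_span_eq (p := p) hpv] at hS
    refine hS.trans (le_of_eq ?_)
    congr 1
    exact Nat.card_congr
      { toFun := fun x ↦ ⟨x.1, x.2.1.1, x.2.2, x.2.1.2⟩
        invFun := fun x ↦ ⟨x.1, ⟨x.2.1, x.2.2.2⟩, x.2.2.1⟩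
        left_inv := fun _ ↦ rfl
        right_inv := fun _ ↦ rfl }
  have hrep' : ∀ ψ : contOneCocycles (discreteTopRep (absoluteGaloisGroup (v.adicCompletion ℚ))
      (localPoints W (v.adicCompletion ℚ))), (∀ g', ψ.1 g' ∈ A₁) →
      (∀ g', p • ψ.1 g' = 0) → ∃ ψ₀ ∈ S, ∃ t ∈ A₁, p • t = 0 ∧
        ∀ g', ψ.1 g' - ψ₀.1 g' = g' • t - t := by
    intro ψ h1 h2
    obtain ⟨ψ₀, hψ₀, t, ht, h⟩ := hrep ψ (fun g' ↦ ⟨h1 g', h2 g'⟩)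
    exact ⟨ψ₀, hψ₀, t, ht.1, ht.2, h⟩
  -- (S5) assemble
  refine W.localTowerKerPrimary_zero_eq_bot_of_forall_subgroupResKer_eq_zero κ (v.adicCompletion ℚ)
    fun x hx k hk ↦ ?_
  obtain ⟨m, ψ, hψx, hψm, hψ₁⟩ := ResKernelPrimary.exists_kerValued_cocycle_of_pow_smul_eq_zero
    (localSubgroup κ.kerSubgroup (v.adicCompletion ℚ)) g
    hgen' hcont p A₁ hA₁ hdiv hdiv₁ htor hnp hx hk
  rw [← hψx]
  exact (KummerCount.oneCocycleClass_eq_zero_of_kerValued hcont p A₁ hA₁ hdiv₁ hTfin hu₁ huG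
    hu S hS' hrep' ψ hψ₁ hψm).2

/-- **T-T3M F2-M — `𝒦_{v,0}[p^∞] = 0` at an ADDITIVE `v ∋ p` along ANY stable `p`-divisible
subgroup with torsion quotient, cyclic `A₁[p]` and a moving element of `(ker κ)_v`.** The generic core
with `hTfin`/`hu` DERIVED from p07's FixedLevel engine (§1). Instances: `A₁ = ker red` of a good
model (row T-T3B F5: additive potentially good ordinary), `A₁ = Ψ(𝒪̄ˣ)` of a twisted Tate
parametrisation (row T-T3M F4-M: additive potentially multiplicative — Delbourgo 1998 §2.2 Lemma (ii)).
[cite: GreenbergLNM1716, §3 Lemma 3.4 (p. 89) and Prop. 3.8 (p. 95)]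
[cite: MilneADT2006, Ch. I §2, Thm. 2.8 (p. 31) and Cor. 2.3] -/
theorem localTowerKerPrimary_zero_eq_bot_of_stableSubgroup (hpv : ((p : ℕ) : 𝓞 ℚ) ∈ v.asIdeal)
    (hadd : W.HasAdditiveReductionAt v) (κ : ZpExtension ℚ p)
    (A₁ : AddSubgroup (localPoints W (v.adicCompletion ℚ)))
    (hA₁ : ∀ (σ : absoluteGaloisGroup (v.adicCompletion ℚ)) (a : localPoints W (v.adicCompletion ℚ)),
      a ∈ A₁ → σ • a ∈ A₁)
    (hdiv₁ : ∀ a ∈ A₁, ∃ b ∈ A₁, p • b = a)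
    (htor : ∀ a : localPoints W (v.adicCompletion ℚ), ∃ n : ℕ, 0 < n ∧ n • a ∈ A₁)
    {P₁ : localPoints W (v.adicCompletion ℚ)} (hP₁ : P₁ ∈ A₁) (hP₁ord : addOrderOf P₁ = p)
    (hK : ∀ P ∈ A₁, p • P = 0 → ∃ c : ℕ, P = c • P₁)
    (hmove : ∃ σ ∈ localSubgroup κ.kerSubgroup (v.adicCompletion ℚ),
      ∃ P : localPoints W (v.adicCompletion ℚ), p • P = 0 ∧ σ • P - P ∉ A₁) :
    W.localTowerKerPrimary κ (v.adicCompletion ℚ) 0 = ⊥ := by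
  obtain ⟨u, hu₁, huG, hu⟩ := exists_fixed_mem_not_pdivisible W p hpv hadd A₁ htor
  exact localTowerKerPrimary_zero_eq_bot_of_stableSubgroup_of_facts W p hpv κ A₁
    (finite_fixed_primary_mem W p hpv hadd A₁) hu₁ huG hu hA₁ hdiv₁ htor hP₁ hP₁ord hK hmove

end Summit.BirchSwinnertonDyer.Rank1Residual.Additive.StableSubgroupLine

end
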